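import Literature.NumberTheory.Transcendental.MultipleZetaRepeatedTwosProofs
import HarnessLib

/-!
# Multiple zeta values — Newton's identities for `ζ(m, m, …, m)` and `ζ({2a}ⁿ) ∈ ℚ π^{2an}`

Sibling proof file of `Literature.NumberTheory.Transcendental.MultipleZetaValues` (D-0014), in the
cone of the named fact `hoffmanSpan_eq_mzvSpace` (Brown 2012, Theorem 1.1). Hoffman's harmonic
algebra restricted to a single letter `z_m` is the algebra of symmetric functions
(Hoffman 1997, §2, Example 1 and Theorem 2.2 ff.: `𝔥¹ ⊇ ℚ⟨z_m⟩`, with `z_m^{∗k} ↔` power sums):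
the repeated values `ζ({m}ᵏ) = ζ(m, …, m)` are the elementary symmetric functions `e_k` and the
`ζ(jm)` the power sums `p_j` of the variables `1/nᵐ`, `n ≥ 1` (Hoffman 1992, Theorem 2.2 and
Corollary 2.3). We prove, from the harmonic product formula `multipleZeta_mul`
(Hoffman 1997, Theorem 4.2, file `MultipleZetaStuffle.lean`):

* `MZV.sum_map_stuffle_singleton_replicate` : the harmonic product `(c) ∗ (m, …, m)` is the sum of
  the `k + 1` insertions of `c` and the `k` contractions `c + m`;
* `multipleZeta_singleton_mul_replicate` : `ζ(c) ζ({m}ᵏ) = ∑ᵢ ζ({m}ⁱ, c, {m}^{k-i}) + ∑ᵢ ζ({m}ⁱ, c+m, {m}^{k-1-i})`;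
* `multipleZeta_replicate_newton` : **Newton's identity**
  `(n+1) ζ({m}ⁿ⁺¹) = ∑_{j=0}^{n} (-1)ʲ ζ((j+1)m) ζ({m}^{n-j})` (`m ≥ 2`);
* `multipleZeta_replicate_even_mem_span_pi_pow` : `ζ({2a}ⁿ) ∈ ℚ · π^{2an}` (`a ≥ 1`) — by
  Newton's identity and Euler's `ζ(2k) ∈ ℚ π^{2k}` (`multipleZeta_two_mul_eq`), i.e. the real
  content of Hoffman 1992, Theorem 2.2 for equal even arguments;
* `multipleZeta_replicate_even_mem_hoffmanSpan` : **`ζ({2a}ⁿ) ∈ hoffmanSpan (2an)`** for all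
  `a ≥ 1`, `n` — Brown's theorem `hoffmanSpan_eq_mzvSpace` for the family `ζ(2a, …, 2a)`
  (e.g. `ζ(4,4)`, `ζ(6,6,6)`, which are not Hoffman elements), in all weights, via
  `π^{2k} ∈ hoffmanSpan (2k)` (`pi_pow_two_mul_mem_hoffmanSpan`, from `ζ({2}ᵏ) = π^{2k}/(2k+1)!`).

No new definitions and no named facts are introduced (pure proofs, D-0026).

## References

* M. E. Hoffman, *Multiple harmonic series*, Pacific J. Math. **152** (1992), 275–290, Theorem 2.2
  and Corollary 2.3 (p. 278). [Hoffman1992]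
* M. E. Hoffman, *The algebra of multiple harmonic series*, J. Algebra **194** (1997), 477–495,
  Theorem 4.2. [Hoffman1997]
* F. Brown, *Mixed Tate motives over ℤ*, Ann. of Math. **175** (2012), 949–976, Theorem 1.1 and
  §3.3. [Brown2012]
-/

noncomputable section

open scoped BigOperators Nat
open Real

namespace Literature.NumberTheory.Transcendental

namespace MZV

/-- `{m}ᵏ = (m, …, m)` is admissible for `m ≥ 2`. [folklore] -/
theorem isAdmissible_replicate {m : ℕ} (hm : 2 ≤ m) : ∀ k : ℕ, IsAdmissible (List.replicate k m)
  | 0 => by simpa using isAdmissible_nil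
  | k + 1 => ⟨fun i hi => by rw [List.eq_of_mem_replicate hi]; omega, fun _ => by simpa using hm⟩

/-- `{m}ᵏ` has weight `k m`. [folklore] -/
@[simp] theorem weight_replicate (k m : ℕ) : weight (List.replicate k m) = k * m := by
  simp [weight, List.sum_replicate]

/-- **The harmonic product `(c) ∗ (m, …, m)`**: summing any function `f` over the indices of
`z_c ∗ z_mᵏ` gives the `k + 1` insertions `({m}ⁱ, c, {m}^{k-i})` plus the `k` contractions
`({m}ⁱ, c + m, {m}^{k-1-i})` (Hoffman 1997, §2 rules (A1)–(A3)). [cite: Hoffman1997, §2 (A1)–(A3)] -/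
theorem sum_map_stuffle_singleton_replicate (f : List ℕ → ℝ) (c m : ℕ) : ∀ k : ℕ,
    ((stuffle [c] (List.replicate k m)).map f).sum =
      ∑ i ∈ Finset.range (k + 1), f (List.replicate i m ++ c :: List.replicate (k - i) m) +
        ∑ i ∈ Finset.range k, f (List.replicate i m ++ (c + m) :: List.replicate (k - (i + 1)) m)
  | 0 => by simp
  | k + 1 => by
      rw [List.replicate_succ, stuffle_cons_cons, stuffle_nil_left, stuffle_nil_left]
      simp only [List.map_append, List.map_cons, List.map_nil, List.sum_append, List.sum_cons,
        List.sum_nil, add_zero, List.map_map]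
      rw [sum_map_stuffle_singleton_replicate (f ∘ List.cons m) c m k,
        Finset.sum_range_succ'
          (fun i => f (List.replicate i m ++ c :: List.replicate (k + 1 - i) m)),
        Finset.sum_range_succ'
          (fun i => f (List.replicate i m ++ (c + m) :: List.replicate (k + 1 - (i + 1)) m))]
      simp only [Function.comp_apply, List.replicate_succ, List.cons_append, List.replicate_zero,
        List.nil_append, Nat.add_sub_add_right, Nat.sub_zero, Nat.add_sub_cancel, zero_add]
      ring

end MZV

open MZV

/-- **`ζ(c) · ζ(m, …, m)`** by the harmonic product (Hoffman 1997, Theorem 4.2): for `c, m ≥ 2`,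
`ζ(c) ζ({m}ᵏ) = ∑_{i=0}^{k} ζ({m}ⁱ, c, {m}^{k-i}) + ∑_{i=0}^{k-1} ζ({m}ⁱ, c+m, {m}^{k-1-i})`.
[cite: Hoffman1997, Theorem 4.2] -/
theorem multipleZeta_singleton_mul_replicate {c m : ℕ} (hc : 2 ≤ c) (hm : 2 ≤ m) (k : ℕ) :
    multipleZeta [c] * multipleZeta (List.replicate k m) =
      ∑ i ∈ Finset.range (k + 1),
          multipleZeta (List.replicate i m ++ c :: List.replicate (k - i) m) +
        ∑ i ∈ Finset.range k,
          multipleZeta (List.replicate i m ++ (c + m) :: List.replicate (k - (i + 1)) m) := by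
  have hc' : IsAdmissible [c] := ⟨fun i hi => by simp at hi; omega, fun _ => hc⟩
  rw [multipleZeta_mul hc' (isAdmissible_replicate hm k)]
  exact sum_map_stuffle_singleton_replicate multipleZeta c m k

/-- **The alternating-row-sum identity** (Brown 2012, proof of Lemma 3.8, for real MZVs; for
`c = m` Newton's identity): for `c, m ≥ 2` and every `n`,
`∑_{i=0}^{n} ζ({m}ⁱ, c, {m}^{n-i}) = ∑_{k=0}^{n} (-1)ᵏ ζ(c + km) ζ({m}^{n-k})`.
Proof (Brown, loc. cit.): write the harmonic products `ζ(c + km) ζ({m}^{n-k})`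
(`multipleZeta_singleton_mul_replicate`) as rows `A_k + A_{k+1}`, where `A_k` is the sum of the
insertions of `c + km` into `{m}^{n-k}` (the contractions `(c + km) + m = c + (k+1)m` of row `k`
are the insertions of row `k + 1`), and take the alternating sum of the rows: it telescopes to
`A_0`. [cite: Brown2012, §3.3 proof of Lemma 3.8] -/
theorem sum_multipleZeta_replicate_insert {c m : ℕ} (hc : 2 ≤ c) (hm : 2 ≤ m) (n : ℕ) :
    ∑ i ∈ Finset.range (n + 1), multipleZeta (List.replicate i m ++ c :: List.replicate (n - i) m) =
      ∑ k ∈ Finset.range (n + 1),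
        (-1) ^ k * (multipleZeta [c + k * m] * multipleZeta (List.replicate (n - k) m)) := by
  -- the insertion sums `A k = ∑_{i ≤ n-k} ζ({m}ⁱ, c + km, {m}^{n-k-i})`
  set A : ℕ → ℝ := fun k => ∑ i ∈ Finset.range (n - k + 1),
    multipleZeta (List.replicate i m ++ (c + k * m) :: List.replicate (n - k - i) m) with hA
  have hck : ∀ k, 2 ≤ c + k * m := fun k => le_trans hc (Nat.le_add_right c _)
  -- the rows: `ζ(c + km) ζ({m}^{n-k}) = A k + A (k+1)` for `k < n`, `= A n` for `k = n`
  have hrow : ∀ k, k < n →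
      multipleZeta [c + k * m] * multipleZeta (List.replicate (n - k) m) = A k + A (k + 1) := by
    intro k hk
    rw [multipleZeta_singleton_mul_replicate (hck k) hm (n - k)]
    simp only [hA]
    congr 1
    rw [show n - (k + 1) + 1 = n - k by omega]
    refine Finset.sum_congr rfl fun i _ => ?_
    rw [show c + k * m + m = c + (k + 1) * m by ring,
      show n - k - (i + 1) = n - (k + 1) - i by omega]
  have hlast : multipleZeta [c + n * m] * multipleZeta (List.replicate (n - n) m) = A n := by
    rw [multipleZeta_singleton_mul_replicate (hck n) hm (n - n)]
    simp only [hA, Nat.sub_self, Finset.sum_range_zero, add_zero]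
  have hA0 : A 0 = ∑ i ∈ Finset.range (n + 1),
      multipleZeta (List.replicate i m ++ c :: List.replicate (n - i) m) := by
    simp only [hA, Nat.sub_zero, zero_mul, add_zero]
  -- telescope the alternating sum of the rows
  have htel : ∀ k, ∑ j ∈ Finset.range k, (-1 : ℝ) ^ j * (A j + A (j + 1)) + (-1) ^ k * A k =
      A 0 := by
    intro k
    induction k with
    | zero => simp
    | succ k ih =>
      rw [Finset.sum_range_succ, pow_succ]
      linear_combination ih
  have hR : ∑ k ∈ Finset.range (n + 1),
      (-1 : ℝ) ^ k * (multipleZeta [c + k * m] * multipleZeta (List.replicate (n - k) m)) = A 0 := by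
    rw [Finset.sum_range_succ, Finset.sum_congr rfl fun k hk => by
      rw [hrow k (Finset.mem_range.mp hk)], hlast]
    exact htel n
  rw [hR, hA0]

/-- **Newton's identity for repeated multiple zeta values** (`m ≥ 2`):
`(n+1) ζ({m}ⁿ⁺¹) = ∑_{k=0}^{n} (-1)ᵏ ζ((k+1)m) ζ({m}^{n-k})` — the Newton–Girard formula
`N e_N = ∑_{j=1}^{N} (-1)^{j-1} p_j e_{N-j}` for the variables `1/nᵐ` (`e_N = ζ({m}ᴺ)`,
`p_j = ζ(jm)`; Hoffman 1992, Theorem 2.2 / Hoffman 1997, Example 1 and Theorem 4.2): the case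
`c = m` of `sum_multipleZeta_replicate_insert`, all `n + 1` insertions of `m` into `{m}ⁿ` being
`{m}ⁿ⁺¹`. [cite: Hoffman1992, Theorem 2.2] -/
theorem multipleZeta_replicate_newton {m : ℕ} (hm : 2 ≤ m) (n : ℕ) :
    ((n : ℝ) + 1) * multipleZeta (List.replicate (n + 1) m) =
      ∑ k ∈ Finset.range (n + 1),
        (-1) ^ k * (multipleZeta [(k + 1) * m] * multipleZeta (List.replicate (n - k) m)) := by
  have h := sum_multipleZeta_replicate_insert hm hm n
  have hl : ∀ i ∈ Finset.range (n + 1),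
      multipleZeta (List.replicate i m ++ m :: List.replicate (n - i) m) =
        multipleZeta (List.replicate (n + 1) m) := by
    intro i hi
    rw [Finset.mem_range] at hi
    rw [← List.replicate_succ, List.replicate_append_replicate,
      show i + (n - i + 1) = n + 1 by omega]
  rw [Finset.sum_congr rfl hl, Finset.sum_const, Finset.card_range, nsmul_eq_mul] at h
  push_cast at h
  rw [h]
  refine Finset.sum_congr rfl fun k _ => ?_
  rw [show m + k * m = (k + 1) * m by ring]

/-- **Brown 2012, Lemma 3.8 for real multiple zeta values** (the alternating sum of the stuffle
rows `ζ(2k+3) ζ({2}^{n-k})`, p. 11 of arXiv:1102.1312): the sum of the `n + 1` Hoffman elements of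
weight `2n + 3` with a single `3` is
`∑_{i=0}^{n} ζ({2}ⁱ, 3, {2}^{n-i}) = ∑_{k=0}^{n} (-1)ᵏ ζ(2k+3) ζ({2}^{n-k})`
(Brown's `ζᵐ₁({2}ⁿ⁺¹) = -2 ∑ᵢ ζᵐ({2}ⁱ 3 {2}^{n-i}) = 2 ∑_{i ≥ 1} (-1)ⁱ ζᵐ(2i+1) ζᵐ({2}^{n+1-i})`
after applying the period map). [cite: Brown2012, §3.3 Lemma 3.8] -/
theorem sum_multipleZeta_twos_insert_three (n : ℕ) :
    ∑ i ∈ Finset.range (n + 1), multipleZeta (List.replicate i 2 ++ 3 :: List.replicate (n - i) 2) =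
      ∑ k ∈ Finset.range (n + 1),
        (-1) ^ k * (multipleZeta [2 * k + 3] * multipleZeta (List.replicate (n - k) 2)) := by
  rw [sum_multipleZeta_replicate_insert (show 2 ≤ 3 by norm_num) le_rfl n]
  refine Finset.sum_congr rfl fun k _ => ?_
  rw [show 3 + k * 2 = 2 * k + 3 by ring]

/-- The same with `ζ({2}ʲ) = π^{2j}/(2j+1)!` substituted (Brown 2012, (3.7) and Lemma 3.8): the sum of
the Hoffman elements of weight `2n + 3` with exactly one `3` is the explicit combination
`∑_{k=0}^{n} (-1)ᵏ π^{2(n-k)}/(2(n-k)+1)! · ζ(2k+3)` of odd zeta values — the trace over the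
insertion position of Zagier's evaluation of `ζ(2, …, 2, 3, 2, …, 2)` (Brown 2012, Theorem 4.1).
[cite: Brown2012, §3.3 Lemma 3.8 and eq. (3.7)] -/
theorem sum_multipleZeta_twos_insert_three_eq_sum_pi_pow (n : ℕ) :
    ∑ i ∈ Finset.range (n + 1), multipleZeta (List.replicate i 2 ++ 3 :: List.replicate (n - i) 2) =
      ∑ k ∈ Finset.range (n + 1),
        (-1) ^ k * π ^ (2 * (n - k)) / (2 * (n - k) + 1)! * multipleZeta [2 * k + 3] := by
  rw [sum_multipleZeta_twos_insert_three]
  refine Finset.sum_congr rfl fun k _ => ?_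
  rw [multipleZeta_replicate_two]
  ring

/-- The product of `ℚ π^p` and `ℚ π^q` lies in `ℚ π^{p+q}`. [folklore] -/
theorem mul_mem_span_pi_pow {x y : ℝ} {p q : ℕ} (hx : x ∈ Submodule.span ℚ {π ^ p})
    (hy : y ∈ Submodule.span ℚ {π ^ q}) : x * y ∈ Submodule.span ℚ {π ^ (p + q)} := by
  rw [Submodule.mem_span_singleton] at hx hy ⊢
  obtain ⟨a, rfl⟩ := hx
  obtain ⟨b, rfl⟩ := hy
  refine ⟨a * b, ?_⟩
  rw [Rat.smul_def, Rat.smul_def, Rat.smul_def, pow_add]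
  push_cast
  ring

/-- `ζ(2k) ∈ ℚ π^{2k}` for `k ≥ 1` (Euler). [cite: ZagierECM1994, §9] -/
theorem multipleZeta_two_mul_mem_span_pi_pow {k : ℕ} (hk : k ≠ 0) :
    multipleZeta [2 * k] ∈ Submodule.span ℚ {π ^ (2 * k)} := by
  rw [Submodule.mem_span_singleton]
  refine ⟨(-1) ^ (k + 1) * 2 ^ (2 * k - 1) * bernoulli (2 * k) / (2 * k)!, ?_⟩
  rw [multipleZeta_two_mul_eq hk, Rat.smul_def]
  push_cast
  ring

/-- **`ζ({2a}ⁿ) ∈ ℚ π^{2an}`** for `a ≥ 1` (Hoffman 1992, Theorem 2.2 with all exponents `2a`: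
`ζ(2a, …, 2a)` is a rational polynomial in the `ζ(2aj) ∈ ℚ π^{2aj}`), by strong induction on `n`
from Newton's identity `multipleZeta_replicate_newton`. [cite: Hoffman1992, Theorem 2.2] -/
theorem multipleZeta_replicate_even_mem_span_pi_pow {a : ℕ} (ha : a ≠ 0) (n : ℕ) :
    multipleZeta (List.replicate n (2 * a)) ∈ Submodule.span ℚ {π ^ (2 * a * n)} := by
  induction n using Nat.strong_induction_on with
  | _ n ih =>
    rcases n with _ | n
    · simp only [List.replicate_zero, multipleZeta_nil, mul_zero, pow_zero]
      exact Submodule.subset_span rfl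
    · have h2a : 2 ≤ 2 * a := by omega
      have hN := multipleZeta_replicate_newton h2a n
      have hsum : ∑ j ∈ Finset.range (n + 1), (-1 : ℝ) ^ j *
          (multipleZeta [(j + 1) * (2 * a)] * multipleZeta (List.replicate (n - j) (2 * a))) ∈
            Submodule.span ℚ {π ^ (2 * a * (n + 1))} := by
        refine Submodule.sum_mem _ fun j hj => ?_
        rw [Finset.mem_range] at hj
        have h1 : multipleZeta [(j + 1) * (2 * a)] ∈ Submodule.span ℚ {π ^ (2 * ((j + 1) * a))} := by
          rw [show (j + 1) * (2 * a) = 2 * ((j + 1) * a) by ring]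
          exact multipleZeta_two_mul_mem_span_pi_pow (by positivity)
        have h2 := mul_mem_span_pi_pow h1 (ih (n - j) (by omega))
        have hjn : j + 1 + (n - j) = n + 1 := by omega
        rw [show 2 * ((j + 1) * a) + 2 * a * (n - j) = 2 * a * (n + 1) by
          rw [← hjn]; ring] at h2
        rw [show (-1 : ℝ) ^ j = ((-1 : ℚ) ^ j : ℚ) by push_cast; rfl, ← Rat.smul_def]
        exact Submodule.smul_mem _ _ h2
      rw [← hN] at hsum
      have hn1 : ((n : ℚ) + 1) ≠ 0 := by positivity
      have key : multipleZeta (List.replicate (n + 1) (2 * a)) =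
          ((n : ℚ) + 1)⁻¹ • (((n : ℝ) + 1) * multipleZeta (List.replicate (n + 1) (2 * a))) := by
        rw [Rat.smul_def]
        push_cast
        field_simp
      rw [key]
      exact Submodule.smul_mem _ _ hsum

/-- **`ζ(2a, …, 2a) ∈ hoffmanSpan (2an)`** for all `a ≥ 1` and `n` — Brown's theorem
`hoffmanSpan_eq_mzvSpace` (Theorem 1.1) for the family `ζ({2a}ⁿ)`, in all weights: e.g.
`ζ(4,4) ∈ hoffmanSpan 8`, `ζ(6,6,6) ∈ hoffmanSpan 18`. From `ζ({2a}ⁿ) ∈ ℚ π^{2an}` and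
`π^{2k} = (2k+1)! ζ({2}ᵏ) ∈ hoffmanSpan (2k)`. [cite: Brown2012, Theorem 1.1] -/
theorem multipleZeta_replicate_even_mem_hoffmanSpan {a : ℕ} (ha : a ≠ 0) (n : ℕ) :
    multipleZeta (List.replicate n (2 * a)) ∈ hoffmanSpan (2 * a * n) := by
  have h := multipleZeta_replicate_even_mem_span_pi_pow ha n
  rw [show 2 * a * n = 2 * (a * n) by ring] at h ⊢
  exact span_pi_pow_le_hoffmanSpan (a * n) h

/-- The weight space statement: `ζ({2a}ⁿ) ∈ hoffmanSpan (weight {2a}ⁿ)`. [cite: Brown2012, Theorem 1.1] -/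
theorem multipleZeta_replicate_even_mem_hoffmanSpan_weight {a : ℕ} (ha : a ≠ 0) (n : ℕ) :
    multipleZeta (List.replicate n (2 * a)) ∈ hoffmanSpan (weight (List.replicate n (2 * a))) := by
  rw [weight_replicate, show n * (2 * a) = 2 * a * n by ring]
  exact multipleZeta_replicate_even_mem_hoffmanSpan ha n

end Literature.NumberTheory.Transcendental
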